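import Mathlib
import Literature.AlgebraicGeometry.Motives.AbelianVarietyCohomologyExteriorH1
import Literature.AlgebraicGeometry.HodgeTheory.AbelianVarietyEndomorphismsHOne

/-!
# Crux `HodgeAbelianVarieties` (stmt-HodgeConjecture-1333), line `cm-pivot-andre` — André with CM targets, module L3a: the wedge basis of `Hᵈ(B(ℂ); ℂ)`

`H•(B(ℂ); ℂ) = ⋀• H¹(B(ℂ); ℂ)` for a complex abelian variety `B` (tree: `abelianVarietyCohomologyExteriorH1_holds`,
Hopf). From a basis `𝔅` of `H¹(B(ℂ); ℂ)` indexed by `Fin N × Fin n` (the line basis of module L2a) this module produces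
the wedge basis `Bw` of `Hᵈ(B(ℂ); ℂ)` indexed by the `d`-element subsets `S`, and records the one fact the André
construction uses about it: an endomorphism `f` of `B` with `f^* 𝔅 i = a i • 𝔅 i` acts on `Bw S` by the scalar
`∏_{i ∈ S} a i` (naturality of iterated cup products, `map_cupPowOne`; the pattern of
`finrank_pullbackEigenclasses_pow_eq_one` in `AbelianVarietyEndomorphismsHOne`).
-/

set_option linter.dupNamespace false

noncomputable section

namespace Summit.HodgeConjecture.HodgeConjecture.Theorems.HodgeAbelianVarieties.CMPivotAndre

open CategoryTheory
open Literature.AlgebraicTopology.SingularHomology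
open Literature.AlgebraicGeometry Literature.AlgebraicGeometry.Motives Literature.AlgebraicGeometry.HodgeTheory

/-- **The wedge basis of `Hᵈ(B(ℂ); ℂ)` and the diagonal action of endomorphisms on it.** For a basis `𝔅` of
`H¹(B(ℂ); ℂ)` indexed by `Fin N × Fin n` there is a basis `Bw` of `Hᵈ(B(ℂ); ℂ)` indexed by the `d`-element subsets
`S ⊆ Fin N × Fin n` such that every endomorphism `f` of `B` which is diagonal on `𝔅` (`f^* 𝔅 i = a i • 𝔅 i`) acts
on `Bw S` by `∏_{i ∈ S} a i`. (`Bw S = 𝔅 i₁ ⌣ ⋯ ⌣ 𝔅 i_d` for the increasing enumeration of `S` in an auxiliary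
linear order; `H• = ⋀• H¹`, Hopf.) [cite: LangeBirkenhake1992, Lemma 1.1.17 and Exercise 1.1.6 (7)]
[cite: MumfordAV1970, §1 (3)–(4)] -/
theorem exists_andreWedgeBasis : ∀ {N n : ℕ} (d : ℕ) (B : Literature.AlgebraicGeometry.Motives.AbelianVariety ℂ) (𝔅 : Module.Basis (Fin N × Fin n) ℂ (Literature.AlgebraicGeometry.HodgeTheory.complexBetti B.X 1)), ∃ Bw : Module.Basis (Set.powersetCard (Fin N × Fin n) d) ℂ (Literature.AlgebraicGeometry.HodgeTheory.complexBetti B.X d), ∀ (f : B ⟶ B) (a : Fin N × Fin n → ℂ), (∀ i, Literature.AlgebraicGeometry.HodgeTheory.complexBetti.map f.hom.hom.hom 1 (𝔅 i) = a i • 𝔅 i) → ∀ S, Literature.AlgebraicGeometry.HodgeTheory.complexBetti.map f.hom.hom.hom d (Bw S) = (∏ i ∈ (S : Finset (Fin N × Fin n)), a i) • Bw S := by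
  intro N n d B 𝔅
  classical
  letI : LinearOrder (Fin N × Fin n) :=
    LinearOrder.lift' (finProdFinEquiv : Fin N × Fin n ≃ Fin (N * n)) finProdFinEquiv.injective
  have hΛ : HasExteriorCohomologyH1 ℂ (ComplexPoints B.X) := AbelianVariety.hasExteriorCohomologyH1_complexPoints B
  let Bw : Module.Basis (Set.powersetCard (Fin N × Fin n) d) ℂ (complexBetti B.X d) :=
    (𝔅.exteriorPower d).map (hΛ.equiv d)
  refine ⟨Bw, ?_⟩
  intro f a ha S
  have hBw : Bw S = cupPowOne ℂ (ComplexPoints B.X) d (𝔅 ∘ (Set.powersetCard.ofFinEmbEquiv.symm S)) := by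
    change hΛ.equiv d ((𝔅.exteriorPower d) S) = _
    rw [exteriorPower.basis_apply, HasExteriorCohomologyH1.equiv_apply, exteriorPower.ιMulti_family,
      wedgeToCup_ιMulti]
  rw [hBw]
  change singularCohomology.map ℂ ℂ (AlgPoints.mapContinuous (L := ℂ) f.hom.hom.hom) d (cupPowOne ℂ _ d _) = _
  rw [map_cupPowOne]
  have e : (fun i => singularCohomology.map ℂ ℂ (AlgPoints.mapContinuous (L := ℂ) f.hom.hom.hom) 1
      ((𝔅 ∘ (Set.powersetCard.ofFinEmbEquiv.symm S)) i)) =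
      fun i => a (Set.powersetCard.ofFinEmbEquiv.symm S i) • (𝔅 ∘ (Set.powersetCard.ofFinEmbEquiv.symm S)) i := by
    funext i
    exact ha _
  rw [e, MultilinearMap.map_smul_univ]
  congr 1
  -- `∏ over the enumeration = ∏ over S`
  have hinj : Function.Injective (Set.powersetCard.ofFinEmbEquiv.symm S) :=
    (Set.powersetCard.ofFinEmbEquiv.symm S).injective
  rw [← Finset.prod_image (f := a) hinj.injOn]
  refine Finset.prod_congr ?_ fun _ _ => rfl
  ext i
  rw [Finset.mem_image]
  constructor
  · rintro ⟨k, _, rfl⟩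
    exact (Set.powersetCard.mem_range_ofFinEmbEquiv_symm_iff_mem S _).1 ⟨k, rfl⟩
  · intro hi
    obtain ⟨k, hk⟩ := (Set.powersetCard.mem_range_ofFinEmbEquiv_symm_iff_mem S i).2 hi
    exact ⟨k, Finset.mem_univ _, hk⟩

end Summit.HodgeConjecture.HodgeConjecture.Theorems.HodgeAbelianVarieties.CMPivotAndre

end
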